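import Summits.CriticalPhenomena.PercolationContinuityZ3.Theorems.PercNearOneGluingAdditiveGluingGDMReduction
import HarnessLib

/-! # Crux `PercNearOneGluing.AdditiveGluing` (stmt-CriticalPhenomena-4576) — PINNED closed cases: leaf and switch after deleting the
# designated relay's own edges into the block (exchange-certificate form, seat (d) round 3)

Support file (`--supports stmt-CriticalPhenomena-4576`); no definitions, no named facts.

By `kernelPin_slack_eq` the block kernel `BG(u,S,a₀)` is a positive multiple of `BG(u⁻,S,a₀)`, `u⁻` = `u` with the pairs `{a₀,s}`,
`s ∈ S`, deleted.  Hence every closed case may be tested in `u⁻` instead of `u`: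
* `blockGood_of_pinnedLeaf`: some block vertex `v ∈ S` with `τ_{u⁻}(a₀) ≤ τ_{u⁻}(v)` ⟹ `BG(u,S,a₀)` (Lemma 5 in `u⁻`) — the designated
  relay exceeds the block only thanks to its own edges into the block;
* `blockGood_of_pinnedSwitch`: `τ_{u⁻/S}(a₀) ≤ τ_{u⁻/S}(d)` for a minimiser `d` of `τ_{u⁻−x'}` (some bystander `x'`) ⟹ `BG(u,S,a₀)` (mod `HBLK`;
  `posDeg_card_pin_le`: `u⁻` has at most as many positive-degree vertices as `u`).
Census (this seat): the pinned leaf closes the n = 7 glued-dominant-minimiser instances found by the gdm hunt (kit j034795) that the plain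
switch leaves open; the lead-c5 all-drift witness (n = 6) stays open.  [cite: KozmaNitzan2024, §3.2 Lemma 5 p. 13, pp. 12–14]
-/

namespace Summit.CriticalPhenomena.PercolationContinuityZ3.Theorems

open MeasureTheory Set
open Literature.Probability.LatticeModels (prodBernoulli)
open Literature.Probability.Percolation (BondConfig openConn openConnIn openGraph openCluster)
open scoped BigOperators

noncomputable section
open Classical

section PinnedClosure

open Literature.Probability.LatticeModels Literature.Probability.Percolation

variable {n : ℕ}

/-- Deleting pairs does not create positive-degree vertices. [folklore] -/
theorem posDeg_card_pin_le (u : Sym2 (Fin n) → unitInterval) (S : Finset (Fin n)) (a₀ : Fin n) :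
    (Finset.univ.filter (fun v : Fin n => ∃ y : Fin n, 0 < ((fun e : Sym2 (Fin n) => if a₀ ∈ e ∧ (∃ y ∈ e, y ∈ S) then (0 : unitInterval) else u e) s(y, v) : ℝ))).card
      ≤ (Finset.univ.filter (fun v : Fin n => ∃ y : Fin n, 0 < (u s(y, v) : ℝ))).card := by
  refine Finset.card_le_card fun v hv => ?_
  simp only [Finset.mem_filter, Finset.mem_univ, true_and] at hv ⊢
  obtain ⟨y, hy⟩ := hv
  refine ⟨y, ?_⟩
  by_cases hc : a₀ ∈ s(y, v) ∧ ∃ y' ∈ s(y, v), y' ∈ S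
  · simp only [hc] at hy
    exact absurd hy (lt_irrefl _)
  · simp only [hc, if_false] at hy
    exact hy

/-- **Pinned leaf**: if, after deleting the pairs joining `a₀` to the block, some block vertex is at least as reliable as `a₀`, then
the block is `a₀`-good (worst selection). [cite: KozmaNitzan2024, Lemma 5 p. 13] -/
theorem blockGood_of_pinnedLeaf (u : Sym2 (Fin n) → unitInterval) (A S : Finset (Fin n)) (b a₀ v : Fin n) (hb : b ∈ A)
    (hSA : Disjoint S A) (ha₀ : a₀ ∈ A) (hv : v ∈ S)
    (hle : (prodBernoulli (fun e : Sym2 (Fin n) => if a₀ ∈ e ∧ (∃ y ∈ e, y ∈ S) then (0 : unitInterval) else u e)).real (openConn a₀ b) ≤ (prodBernoulli (fun e : Sym2 (Fin n) => if a₀ ∈ e ∧ (∃ y ∈ e, y ∈ S) then (0 : unitInterval) else u e)).real (openConn v b)) :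
    (prodBernoulli u).real (openConn a₀ b)
          + (prodBernoulli u).real
              ((openConn a₀ b)ᶜ ∩ (⋃ v ∈ S, openConn a₀ v) ∩ (⋃ v ∈ S, openConn v b))
        ≤ (prodBernoulli u).real (⋃ v ∈ S, openConn v b)
          + (∑ W ∈ (Finset.univ : Finset (Finset (Fin n))).filter (fun W => Disjoint W A),
              (prodBernoulli u).real
                  {ω : BondConfig (Fin n) | ∀ z : Fin n, (z ∈ W ↔ ω ∈ ⋃ v ∈ S, openConn v z)}
                * A.inf' ⟨b, hb⟩ (fun a => (prodBernoulli u).real (openConnIn ((W : Set (Fin n))ᶜ) a b))) := by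
  have hbS : b ∉ S := fun h => Finset.disjoint_left.1 hSA h hb
  exact blockGood_of_pinDesignated u A S b a₀ hb hSA ha₀ (blockGood_of_leaf (fun e : Sym2 (Fin n) => if a₀ ∈ e ∧ (∃ y ∈ e, y ∈ S) then (0 : unitInterval) else u e) A S b a₀ v hb hv hbS hle)

/-- **Pinned switch** (mod `HBLK`): designation switching performed in the weighting `u⁻` with the `a₀–S` pairs deleted.
[cite: KozmaNitzan2024, §3.2 Thms 4–5 pp. 12–14] -/
theorem blockGood_of_pinnedSwitch (u : Sym2 (Fin n) → unitInterval) (A S : Finset (Fin n)) (b a₀ x' d : Fin n) (hb : b ∈ A)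
    (hSA : Disjoint S A) (ha₀ : a₀ ∈ A) (hx' : x' ∈ S) (hd : d ∈ A)
    (hy : ∃ y : Fin n, ((fun e : Sym2 (Fin n) => if a₀ ∈ e ∧ (∃ y ∈ e, y ∈ S) then (0 : unitInterval) else u e) s(x', y) : ℝ) ≠ 0)
    (hdmin : ∀ a ∈ A, (prodBernoulli (fun e : Sym2 (Fin n) => if (∃ y ∈ e, y ∈ ({x'} : Finset (Fin n))) then (0 : unitInterval) else (fun e : Sym2 (Fin n) => if a₀ ∈ e ∧ (∃ y ∈ e, y ∈ S) then (0 : unitInterval) else u e) e)).real (openConn d b) ≤ (prodBernoulli (fun e : Sym2 (Fin n) => if (∃ y ∈ e, y ∈ ({x'} : Finset (Fin n))) then (0 : unitInterval) else (fun e : Sym2 (Fin n) => if a₀ ∈ e ∧ (∃ y ∈ e, y ∈ S) then (0 : unitInterval) else u e) e)).real (openConn a b))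
    (hle : (prodBernoulli (fun e : Sym2 (Fin n) => if (∀ y ∈ e, y ∈ S) ∧ ¬ e.IsDiag then 1 else (fun e : Sym2 (Fin n) => if a₀ ∈ e ∧ (∃ y ∈ e, y ∈ S) then (0 : unitInterval) else u e) e)).real (openConn a₀ b) ≤ (prodBernoulli (fun e : Sym2 (Fin n) => if (∀ y ∈ e, y ∈ S) ∧ ¬ e.IsDiag then 1 else (fun e : Sym2 (Fin n) => if a₀ ∈ e ∧ (∃ y ∈ e, y ∈ S) then (0 : unitInterval) else u e) e)).real (openConn d b))
    (hblk : (∀ w' : Sym2 (Fin n) → unitInterval,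
        (Finset.univ.filter (fun v : Fin n => ∃ y : Fin n, 0 < (w' s(y, v) : ℝ))).card
          < (Finset.univ.filter (fun v : Fin n => ∃ y : Fin n, 0 < (u s(y, v) : ℝ))).card →
        ∀ (A' S' : Finset (Fin n)) (b' d' : Fin n) (hb' : b' ∈ A'), Disjoint S' A' → d' ∈ A' →
        (∀ a ∈ A', (prodBernoulli w').real (openConn d' b') ≤ (prodBernoulli w').real (openConn a b')) →
        (prodBernoulli w').real (openConn d' b')
          + (prodBernoulli w').real
              ((openConn d' b')ᶜ ∩ (⋃ v ∈ S', openConn d' v) ∩ (⋃ v ∈ S', openConn v b'))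
        ≤ (prodBernoulli w').real (⋃ v ∈ S', openConn v b')
          + (∑ W ∈ (Finset.univ : Finset (Finset (Fin n))).filter (fun W => Disjoint W A'),
              (prodBernoulli w').real
                  {ω : BondConfig (Fin n) | ∀ z : Fin n, (z ∈ W ↔ ω ∈ ⋃ v ∈ S', openConn v z)}
                * A'.inf' ⟨b', hb'⟩ (fun a => (prodBernoulli w').real (openConnIn ((W : Set (Fin n))ᶜ) a b'))))) :
    (prodBernoulli u).real (openConn a₀ b)
          + (prodBernoulli u).real
              ((openConn a₀ b)ᶜ ∩ (⋃ v ∈ S, openConn a₀ v) ∩ (⋃ v ∈ S, openConn v b))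
        ≤ (prodBernoulli u).real (⋃ v ∈ S, openConn v b)
          + (∑ W ∈ (Finset.univ : Finset (Finset (Fin n))).filter (fun W => Disjoint W A),
              (prodBernoulli u).real
                  {ω : BondConfig (Fin n) | ∀ z : Fin n, (z ∈ W ↔ ω ∈ ⋃ v ∈ S, openConn v z)}
                * A.inf' ⟨b, hb⟩ (fun a => (prodBernoulli u).real (openConnIn ((W : Set (Fin n))ᶜ) a b))) := by
  have hblk' : (∀ w' : Sym2 (Fin n) → unitInterval,
        (Finset.univ.filter (fun v : Fin n => ∃ y : Fin n, 0 < (w' s(y, v) : ℝ))).card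
          < (Finset.univ.filter (fun v : Fin n => ∃ y : Fin n, 0 < ((fun e : Sym2 (Fin n) => if a₀ ∈ e ∧ (∃ y ∈ e, y ∈ S) then (0 : unitInterval) else u e) s(y, v) : ℝ))).card →
        ∀ (A' S' : Finset (Fin n)) (b' d' : Fin n) (hb' : b' ∈ A'), Disjoint S' A' → d' ∈ A' →
        (∀ a ∈ A', (prodBernoulli w').real (openConn d' b') ≤ (prodBernoulli w').real (openConn a b')) →
        (prodBernoulli w').real (openConn d' b')
          + (prodBernoulli w').real
              ((openConn d' b')ᶜ ∩ (⋃ v ∈ S', openConn d' v) ∩ (⋃ v ∈ S', openConn v b'))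
        ≤ (prodBernoulli w').real (⋃ v ∈ S', openConn v b')
          + (∑ W ∈ (Finset.univ : Finset (Finset (Fin n))).filter (fun W => Disjoint W A'),
              (prodBernoulli w').real
                  {ω : BondConfig (Fin n) | ∀ z : Fin n, (z ∈ W ↔ ω ∈ ⋃ v ∈ S', openConn v z)}
                * A'.inf' ⟨b', hb'⟩ (fun a => (prodBernoulli w').real (openConnIn ((W : Set (Fin n))ᶜ) a b')))) :=
    fun w' hw' => hblk w' (lt_of_lt_of_le hw' (posDeg_card_pin_le u S a₀))
  exact blockGood_of_pinDesignated u A S b a₀ hb hSA ha₀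
    (blockGood_of_switch (fun e : Sym2 (Fin n) => if a₀ ∈ e ∧ (∃ y ∈ e, y ∈ S) then (0 : unitInterval) else u e) A S b a₀ x' d hb hSA hx' hd hy hdmin hle hblk')

end PinnedClosure

end

end Summit.CriticalPhenomena.PercolationContinuityZ3.Theorems
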